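import Literature.Geometry.Riemannian.NormalExponentialMap
import Literature.Geometry.Riemannian.NormalExpGaussLemma
import Mathlib.Analysis.SpecialFunctions.SmoothTransition
import Mathlib.Analysis.Calculus.BumpFunction.InnerProduct
import HarnessLib

/-!
# Variations of a normal geodesic with first endpoint on a submanifold (O'Neill, Lemma 10.49)

For a semi-Riemannian (here: any affinely connected) manifold `M`, an immersed hypersurface
`ι : N → M` with a smooth transverse field `ν` along `ι`, and the normal geodesic
`γ(t) = exp_{ι z₀}(t ν(z₀))`, `t ∈ [0, L]`, O'Neill 1983, Ch. 10, Lemma 49 realises every field `V`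
along `γ` with `V(0)` tangent to the hypersurface and `V(L) = 0` as the variation vector field of a
`(P, q)`-VARIATION of `γ`: a two-parameter map `x(t, σ)` with `x(t, 0) = γ(t)`, first transverse
curve `σ ↦ x(0, σ)` IN THE HYPERSURFACE and last transverse curve constant. This is the device by
which the second variation / index form arguments with an endmanifold (O'Neill, Ch. 10,
Cor. 26, Thm. 28, Prop. 37; the Hawking–Penrose singularity theorems, Ch. 14, Thm. 55A/B) compare
the length of `γ` with that of nearby curves FROM THE SUBMANIFOLD.

* `exists_endmanifold_variation` — the statement above, with `x` smooth on all of `ℝ × ℝ`, the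
  foot-point curve `ζ` (`x(0, σ) = ι(ζ σ)`) smooth on all of `ℝ` with `ζ(0) = z₀`,
  `ζ'(0) = w₀` where `V(0) = dι_{z₀}(w₀)`, and the base curve / variation field identities on a
  neighbourhood of `[0, L]`.
* `exists_endmanifold_variation_local` — the construction: the floating variation
  `x₁(t, σ) = exp_{γ t}(σ V(t))` (O'Neill, p. 267: "the exponential formula
  `x(u, v) = exp_{α(u)}(v V(u))` produces a … variation of `α` whose vector field is `V`") is
  corrected near the foot through the local inverse `Ψ = (Ψ₁, Ψ₂)` of the normal exponential map
  `E(z, s) = exp_{ι z}(s ν z)` at `(z₀, 0)` (`isLocalDiffeomorphAt_normalExp_zero`, Lee 2018,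
  Thm. 5.25): `x(t, σ) = E(Ψ₁ x₁(t, σ), Ψ₂ x₁(t, σ) - (1 - χ t)·Ψ₂ x₁(0, σ))` for `t ≤ 3t₁/4` and
  `x = x₁` beyond, `χ` a smooth cutoff; the correction is of second order in `σ` because
  `dΨ(dι w₀) = (w₀, 0)` (`velocity_comp_sub_correction`), so the variation field is still `V`.
  (O'Neill's own two-line proof modifies instead an unspecified variation "easy to find"; the
  present explicit formula is that modification with the normal exponential chart.)
* `exists_clamped_variation`, `exists_smooth_clamp_Icc`, `exists_smooth_cutoff` — smooth clamps
  making a map defined near `[0, L] × {0}` globally smooth without changing it near `[0, L] × {0}`.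

No definitions and no named facts are introduced (D-0026).

## References

* B. O'Neill, *Semi-Riemannian geometry with applications to relativity*, Academic Press 1983,
  Ch. 10, Lemma 49 (and Def. 25, Cor. 26, p. 267). [ONeillSemiRiemannian1983]
* J. M. Lee, *Introduction to Riemannian Manifolds*, 2nd ed., Springer 2018, Thm. 5.25,
  Prop. 5.19. [LeeRiemannianManifolds2018]
-/

noncomputable section

open Bundle Set Filter Function
open scoped Manifold ContDiff Topology

namespace Literature.Geometry.Riemannian

open Literature.Geometry.Lorentzian

variable {E : Type*} [NormedAddCommGroup E] [NormedSpace ℝ E] {H : Type*} [TopologicalSpace H]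
  {I : ModelWithCorners ℝ E H} {M : Type*} [TopologicalSpace M] [ChartedSpace H M]
  {E' : Type*} [NormedAddCommGroup E'] [NormedSpace ℝ E'] {H' : Type*} [TopologicalSpace H']
  {I' : ModelWithCorners ℝ E' H'} {N : Type*} [TopologicalSpace N] [ChartedSpace H' N]

/-! ### Two calculus lemmas on velocities -/

/-- **A second-order correction does not change the velocity.** For `P : ℝ → N × ℝ`
differentiable at `0`, `F : N × ℝ → M` differentiable at `P 0` and a real function `r` with
`r 0 = 0`, `r' 0 = 0`, the curve `σ ↦ F((P σ).1, (P σ).2 - c·r σ)` has the same velocity at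
`σ = 0` as `F ∘ P` (chain rule; the corrected curve `σ ↦ ((P σ).1, (P σ).2 - c r σ)` has the same
value and the same derivative at `0` as `P`). [folklore] -/
theorem velocity_comp_sub_correction {P : ℝ → N × ℝ} {F : N × ℝ → M} {r : ℝ → ℝ} (c : ℝ)
    (hP : MDifferentiableAt 𝓘(ℝ, ℝ) (I'.prod 𝓘(ℝ, ℝ)) P 0)
    (hF : MDifferentiableAt (I'.prod 𝓘(ℝ, ℝ)) I F (P 0))
    (hr : HasMFDerivAt 𝓘(ℝ, ℝ) 𝓘(ℝ, ℝ) r 0 (0 : TangentSpace 𝓘(ℝ, ℝ) (0 : ℝ) →L[ℝ] ℝ))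
    (hr0 : r 0 = 0) :
    velocity I (fun σ ↦ F ((P σ).1, (P σ).2 - c * r σ)) 0 = velocity I (F ∘ P) 0 := by
  set Q : ℝ → N × ℝ := fun σ ↦ ((P σ).1, (P σ).2 - c * r σ) with hQ
  have hQ0 : Q 0 = P 0 := by
    simp only [hQ, hr0, mul_zero, sub_zero]
  set dP := mfderiv 𝓘(ℝ, ℝ) (I'.prod 𝓘(ℝ, ℝ)) P 0 with hdP
  have hPd : HasMFDerivAt 𝓘(ℝ, ℝ) (I'.prod 𝓘(ℝ, ℝ)) P 0 dP := hP.hasMFDerivAt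
  -- the two components of `Q`
  have h1 : HasMFDerivAt 𝓘(ℝ, ℝ) I' (fun σ ↦ (P σ).1) 0
      ((ContinuousLinearMap.fst ℝ (TangentSpace I' (P 0).1) (TangentSpace 𝓘(ℝ, ℝ) (P 0).2)).comp
        dP) :=
    (hasMFDerivAt_fst (I := I') (I' := 𝓘(ℝ, ℝ)) (P 0)).comp 0 hPd
  set D₂ : TangentSpace 𝓘(ℝ, ℝ) (0 : ℝ) →L[ℝ] ℝ :=
    (ContinuousLinearMap.snd ℝ (TangentSpace I' (P 0).1) (TangentSpace 𝓘(ℝ, ℝ) (P 0).2)).comp dP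
    with hD₂
  have h2 : HasMFDerivAt 𝓘(ℝ, ℝ) 𝓘(ℝ, ℝ) (fun σ ↦ (P σ).2) 0 D₂ :=
    (hasMFDerivAt_snd (I := I') (I' := 𝓘(ℝ, ℝ)) (P 0)).comp 0 hPd
  have h2' : HasMFDerivAt 𝓘(ℝ, ℝ) 𝓘(ℝ, ℝ) ((fun σ ↦ (P σ).2) - c • r) 0
      (D₂ - c • (0 : TangentSpace 𝓘(ℝ, ℝ) (0 : ℝ) →L[ℝ] ℝ)) :=
    h2.sub (hr.const_smul c)
  have hQd : HasMFDerivAt 𝓘(ℝ, ℝ) (I'.prod 𝓘(ℝ, ℝ)) Q 0 dP := by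
    have := h1.prodMk h2'
    convert this using 1
    all_goals first
      | rfl
      | (rw [smul_zero, sub_zero]
         ext1
         rfl)
  -- chain rule for `F ∘ Q` and `F ∘ P`
  have hFQ : HasMFDerivAt (I'.prod 𝓘(ℝ, ℝ)) I F (Q 0) (mfderiv (I'.prod 𝓘(ℝ, ℝ)) I F (P 0)) := by
    rw [hQ0]
    exact hF.hasMFDerivAt
  have hcompQ := (hFQ.comp 0 hQd).mfderiv
  have hcompP := (hF.hasMFDerivAt.comp 0 hPd).mfderiv
  change mfderiv 𝓘(ℝ, ℝ) I (F ∘ Q) 0 1 = mfderiv 𝓘(ℝ, ℝ) I (F ∘ P) 0 1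
  rw [hcompQ, hcompP]
  rfl

/-- **A local right inverse in the middle does not change the velocity**: if `F ∘ Ψ = id` near
`c 0` and `c` is continuous at `0`, then `(F ∘ Ψ ∘ c)'(0) = c'(0)` (the two curves agree near
`0`). [folklore] -/
theorem velocity_comp_rightInverse {P' : Type*} {Ψ : M → P'} {F : P' → M} {c : ℝ → M}
    (hFΨ : ∀ᶠ p in 𝓝 (c 0), F (Ψ p) = p) (hc : ContinuousAt c 0) :
    velocity I (fun σ ↦ F (Ψ (c σ))) 0 = velocity I c 0 :=
  velocity_congr_of_eventuallyEq (I := I) (hc.eventually hFΨ)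

/-! ### Smooth clamps and cutoffs on the real line -/

/-- **A smooth clamp onto a neighbourhood of `[a, b]`**: for `δ > 0` there is a `C^∞` function
`θ : ℝ → ℝ` with values in `(a - δ, b + δ)` and `θ t = t` on a neighbourhood of `[a, b]`
(`θ t = m + (t - m)·χ(t)` for the midpoint `m` and a smooth bump `χ` centred at `m`). [folklore] -/
theorem exists_smooth_clamp_Icc {a b δ : ℝ} (hab : a ≤ b) (hδ : 0 < δ) :
    ∃ θ : ℝ → ℝ, ContDiff ℝ ∞ θ ∧ (∀ t, θ t ∈ Ioo (a - δ) (b + δ)) ∧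
      ∀ᶠ t in 𝓝ˢ (Icc a b), θ t = t := by
  set m : ℝ := (a + b) / 2 with hm
  let χ : ContDiffBump m :=
    ⟨(b - a) / 2 + δ / 2, (b - a) / 2 + δ, by linarith, by linarith⟩
  refine ⟨fun t ↦ m + (t - m) * χ t, ?_, fun t ↦ ?_, ?_⟩
  · exact contDiff_const.add ((contDiff_id.sub contDiff_const).mul χ.contDiff)
  · have h1 : |(t - m) * χ t| ≤ |t - m| := by
      rw [abs_mul, abs_of_nonneg χ.nonneg]
      exact mul_le_of_le_one_right (abs_nonneg _) χ.le_one
    by_cases ht : (b - a) / 2 + δ ≤ dist t m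
    · have h0 : χ t = 0 := χ.zero_of_le_dist ht
      simp only [h0, mul_zero, add_zero, mem_Ioo]
      constructor <;> linarith
    · rw [not_le, Real.dist_eq] at ht
      have h2 := neg_abs_le ((t - m) * χ t)
      have h3 := le_abs_self ((t - m) * χ t)
      simp only [mem_Ioo]
      constructor <;> linarith
  · have hsub : Icc a b ⊆ Metric.ball m χ.rIn := by
      intro t ht
      rw [Metric.mem_ball, Real.dist_eq, abs_lt]
      simp only [mem_Icc] at ht
      change -((b - a) / 2 + δ / 2) < t - m ∧ t - m < (b - a) / 2 + δ / 2
      constructor <;> linarith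
    filter_upwards [Metric.isOpen_ball.mem_nhdsSet.2 hsub] with t ht
    have h1 : χ t = 1 := χ.one_of_mem_closedBall (Metric.ball_subset_closedBall ht)
    simp [h1]

/-- **A smooth cutoff**: for `t₁ > 0` the function `χ t = smoothTransition (4t/t₁ - 1)` is `C^∞`,
vanishes for `t ≤ t₁/4` and equals `1` for `t ≥ t₁/2`. [folklore] -/
theorem exists_smooth_cutoff {t₁ : ℝ} (ht₁ : 0 < t₁) :
    ∃ χ : ℝ → ℝ, ContDiff ℝ ∞ χ ∧ (∀ t ≤ t₁ / 4, χ t = 0) ∧ ∀ t, t₁ / 2 ≤ t → χ t = 1 := by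
  refine ⟨fun t ↦ Real.smoothTransition (4 * t / t₁ - 1), ?_, fun t ht ↦ ?_, fun t ht ↦ ?_⟩
  · exact Real.smoothTransition.contDiff.comp
      (((contDiff_const.mul contDiff_id).div_const _).sub contDiff_const)
  · refine Real.smoothTransition.zero_of_nonpos ?_
    rw [sub_nonpos, div_le_one ht₁]
    linarith
  · refine Real.smoothTransition.one_of_one_le ?_
    rw [le_sub_iff_add_le, le_div_iff₀ ht₁]
    linarith

/-- An open set containing `[a, b]` contains `(a - δ, b + δ)` for some `δ > 0`. [folklore] -/
theorem exists_Ioo_subset_of_Icc_subset {a b : ℝ} (hab : a ≤ b) {O : Set ℝ} (hO : IsOpen O)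
    (h : Icc a b ⊆ O) : ∃ δ > 0, Ioo (a - δ) (b + δ) ⊆ O := by
  obtain ⟨δ₁, hδ₁, h₁⟩ := Metric.isOpen_iff.1 hO a (h (left_mem_Icc.2 hab))
  obtain ⟨δ₂, hδ₂, h₂⟩ := Metric.isOpen_iff.1 hO b (h (right_mem_Icc.2 hab))
  refine ⟨min δ₁ δ₂, lt_min hδ₁ hδ₂, fun t ht ↦ ?_⟩
  rcases lt_or_ge t a with hta | hta
  · refine h₁ ?_
    rw [Metric.mem_ball, Real.dist_eq, abs_lt]
    constructor <;> linarith [ht.1, min_le_left δ₁ δ₂]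
  rcases le_or_gt t b with htb | htb
  · exact h ⟨hta, htb⟩
  · refine h₂ ?_
    rw [Metric.mem_ball, Real.dist_eq, abs_lt]
    constructor <;> linarith [ht.2, min_le_right δ₁ δ₂]

/-! ### Clamping a variation defined near `[0, L] × {0}` -/

section Clamp

variable {ι : N → M}

/-- **Clamping.** Let `x : ℝ → ℝ → M` be `C^∞` near `[0, L] × {0}`, with first transverse curve
`x(0, ·) = ι ∘ ζ` for a curve `ζ` in `N` that is `C^∞` near `0`, last transverse curve constant,
`x(t, 0) = γ t` and `∂_σ x(t, 0) = V t` for `t` near `[0, L]`. Reparametrising both variables by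
smooth clamps (`exists_smooth_clamp_Icc`) gives a variation `C^∞` on all of `ℝ × ℝ` and a curve
`C^∞` on all of `ℝ` with the same endpoint behaviour, the same base curve and the same variation
field near `[0, L]`, and the same initial velocity of the foot-point curve. [folklore] -/
theorem exists_clamped_variation {x : ℝ → ℝ → M} {ζ : ℝ → N} {γ : ℝ → M} {L : ℝ} (hL : 0 ≤ L)
    {V : Π t : ℝ, TangentSpace I (γ t)}
    (hxs : ∀ t ∈ Icc 0 L, ∀ᶠ q in 𝓝 ((t, 0) : ℝ × ℝ),
      ContMDiffAt (𝓘(ℝ, ℝ).prod 𝓘(ℝ, ℝ)) I ∞ (uncurry x) q)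
    (hζs : ∀ᶠ σ in 𝓝 (0 : ℝ), ContMDiffAt 𝓘(ℝ, ℝ) I' ∞ ζ σ)
    (hx0 : ∀ σ, x 0 σ = ι (ζ σ)) (hxL : ∀ σ, x L σ = γ L)
    (hxγ : ∀ᶠ t in 𝓝ˢ (Icc 0 L), x t 0 = γ t)
    (hxV : ∀ᶠ t in 𝓝ˢ (Icc 0 L), velocity I (x t) 0 = V t) :
    ∃ (x' : ℝ → ℝ → M) (ζ' : ℝ → N),
      ContMDiff (𝓘(ℝ, ℝ).prod 𝓘(ℝ, ℝ)) I ∞ (uncurry x') ∧ ContMDiff 𝓘(ℝ, ℝ) I' ∞ ζ' ∧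
      ζ' 0 = ζ 0 ∧ velocity I' ζ' 0 = velocity I' ζ 0 ∧
      (∀ σ, x' 0 σ = ι (ζ' σ)) ∧ (∀ σ, x' L σ = γ L) ∧
      (∀ᶠ t in 𝓝ˢ (Icc 0 L), x' t 0 = γ t) ∧
      (∀ᶠ t in 𝓝ˢ (Icc 0 L), velocity I (x' t) 0 = V t) := by
  -- an open set `U ⊇ [0, L] × {0}` on which `x` is `C^∞`
  set U : Set (ℝ × ℝ) :=
    {q | ∀ᶠ q' in 𝓝 q, ContMDiffAt (𝓘(ℝ, ℝ).prod 𝓘(ℝ, ℝ)) I ∞ (uncurry x) q'} with hU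
  have hUo : IsOpen U := isOpen_setOf_eventually_nhds
  have hUx : ∀ q ∈ U, ContMDiffAt (𝓘(ℝ, ℝ).prod 𝓘(ℝ, ℝ)) I ∞ (uncurry x) q :=
    fun q hq ↦ Filter.Eventually.self_of_nhds hq
  have hKU : Icc 0 L ×ˢ ({0} : Set ℝ) ⊆ U := by
    rintro ⟨t, σ⟩ ⟨ht, hσ⟩
    rw [mem_singleton_iff] at hσ
    subst hσ
    exact hxs t ht
  obtain ⟨A, B, hAo, hBo, hA, hB, hAB⟩ :=
    generalized_tube_lemma isCompact_Icc isCompact_singleton hUo hKU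
  have hB0 : (0 : ℝ) ∈ B := hB rfl
  -- open neighbourhoods of `[0, L]` on which the base curve and the variation field are right
  obtain ⟨O₂, hO₂o, hO₂, hO₂p⟩ := eventually_nhdsSet_iff_exists.1 hxγ
  obtain ⟨O₃, hO₃o, hO₃, hO₃p⟩ := eventually_nhdsSet_iff_exists.1 hxV
  obtain ⟨δ, hδ, hδsub⟩ := exists_Ioo_subset_of_Icc_subset hL ((hAo.inter hO₂o).inter hO₃o)
    (subset_inter (subset_inter hA hO₂) hO₃)
  -- a neighbourhood of `0` in the transverse variable
  have hσn : {σ : ℝ | σ ∈ B ∧ ContMDiffAt 𝓘(ℝ, ℝ) I' ∞ ζ σ} ∈ 𝓝 (0 : ℝ) :=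
    Filter.inter_mem (hBo.mem_nhds hB0) hζs
  obtain ⟨ε, hε, hεsub⟩ := Metric.mem_nhds_iff.1 hσn
  -- the clamps
  obtain ⟨θ₁, hθ₁s, hθ₁m, hθ₁e⟩ := exists_smooth_clamp_Icc hL hδ
  obtain ⟨θ₂, hθ₂s, hθ₂m, hθ₂e⟩ := exists_smooth_clamp_Icc (le_refl (0 : ℝ)) hε
  have hθ₂0e : ∀ᶠ σ in 𝓝 (0 : ℝ), θ₂ σ = σ := by
    rwa [Icc_self, nhdsSet_singleton] at hθ₂e
  have hθ₂0 : θ₂ 0 = 0 := hθ₂0e.self_of_nhds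
  have hθ₁0 : θ₁ 0 = 0 := hθ₁e.self_of_nhdsSet 0 (left_mem_Icc.2 hL)
  have hθ₁L : θ₁ L = L := hθ₁e.self_of_nhdsSet L (right_mem_Icc.2 hL)
  have hθ₂B : ∀ σ, θ₂ σ ∈ B ∧ ContMDiffAt 𝓘(ℝ, ℝ) I' ∞ ζ (θ₂ σ) := fun σ ↦ by
    refine hεsub ?_
    rw [Metric.mem_ball, Real.dist_eq, sub_zero, abs_lt]
    have h := hθ₂m σ
    simp only [zero_sub, zero_add, mem_Ioo] at h
    exact h
  have hθ₁A : ∀ t, θ₁ t ∈ A := fun t ↦ ((hδsub (hθ₁m t)).1).1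
  refine ⟨fun t σ ↦ x (θ₁ t) (θ₂ σ), fun σ ↦ ζ (θ₂ σ), ?_, ?_, ?_, ?_, ?_, ?_, ?_, ?_⟩
  · -- smoothness of the clamped variation
    rintro ⟨t, σ⟩
    have hin : ContMDiffAt (𝓘(ℝ, ℝ).prod 𝓘(ℝ, ℝ)) (𝓘(ℝ, ℝ).prod 𝓘(ℝ, ℝ)) ∞
        (fun q : ℝ × ℝ ↦ (θ₁ q.1, θ₂ q.2)) (t, σ) :=
      (hθ₁s.contMDiff.contMDiffAt.comp (t, σ) contMDiffAt_fst).prodMk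
        (hθ₂s.contMDiff.contMDiffAt.comp (t, σ) contMDiffAt_snd)
    exact (hUx _ (hAB (mk_mem_prod (hθ₁A t) (hθ₂B σ).1))).comp (t, σ) hin
  · -- smoothness of the clamped foot-point curve
    intro σ
    exact (hθ₂B σ).2.comp σ hθ₂s.contMDiff.contMDiffAt
  · simp only [hθ₂0]
  · refine velocity_congr_of_eventuallyEq (I := I') ?_
    filter_upwards [hθ₂0e] with σ hσ
    simp only [hσ]
  · intro σ
    simp only [hθ₁0, hx0]
  · intro σ
    simp only [hθ₁L, hxL]
  · filter_upwards [hθ₁e, hxγ] with t h1 h2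
    simp only [h1, hθ₂0, h2]
  · filter_upwards [hθ₁e, hxV] with t h1 h2
    have hev : (fun σ ↦ x (θ₁ t) (θ₂ σ)) =ᶠ[𝓝 0] x t := by
      filter_upwards [hθ₂0e] with σ hσ
      rw [h1, hσ]
    rw [velocity_congr_of_eventuallyEq (I := I) hev]
    exact h2

end Clamp

/-! ### The endmanifold variation of a normal geodesic -/

section Endmanifold

variable [IsManifold I ∞ M] [FiniteDimensional ℝ E] [CompleteSpace E] [T2Space M]
  [BoundarylessManifold I M] [I.Boundaryless] [I'.Boundaryless] [FiniteDimensional ℝ E']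
  [CompleteSpace E'] [IsManifold I' ∞ N]
  {ι : N → M} {ν : Π z : N, TangentSpace I (ι z)}
  {cov : CovariantDerivative I E (TangentSpace I : M → Type _)}
  [CovariantDerivative.ContMDiffCovariantDerivative cov 1]
  [CovariantDerivative.ContMDiffCovariantDerivative cov (⊤ : ℕ∞)]

/-- **Local form of the endmanifold variation** (O'Neill 1983, Ch. 10, Lemma 49, for the normal
geodesic `γ(t) = exp_{ι z₀}(t ν(z₀))` of an immersed hypersurface `ι : N → M` with smooth
transverse field `ν`). Given `L > 0` with `[0, L]` inside the domain of `γ`, a field `V` along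
`γ`, `C^∞` on an open interval about `[0, L]`, with `V(L) = 0` and `V(0) = dι(w₀)` tangent to the
hypersurface, there are a two-parameter map `x` and a curve `ζ` in `N` with: `x` is `C^∞` near
`[0, L] × {0}`; `ζ` is `C^∞` near `0`, `ζ(0) = z₀`, `ζ'(0) = w₀`; the first transverse curve is
`x(0, σ) = ι(ζ σ)` (foot points on the hypersurface), the last is constant, `x(L, σ) = γ(L)`; and
near `[0, L]` the base curve is `x(t, 0) = γ(t)` with variation field `∂_σ x(t, 0) = V(t)`.
Construction: the floating variation `x₁(t, σ) = exp_{γ t}(σ V t)` is corrected near the foot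
through the local inverse `Ψ = (Ψ₁, Ψ₂)` of the normal exponential map `E(z, s) = exp_{ι z}(s ν z)`
at `(z₀, 0)` (`isLocalDiffeomorphAt_normalExp_zero`):
`x(t, σ) = E(Ψ₁(x₁(t, σ)), Ψ₂(x₁(t, σ)) - (1 - χ(t)) Ψ₂(x₁(0, σ)))` for `t ≤ 3t₁/4` with a smooth
cutoff `χ` (`= 0` near `0`, `= 1` on `[t₁/2, ∞)`), and `x = x₁` beyond; the correction is of second
order in `σ` because `dΨ(dι w₀) = (w₀, 0)`. [cite: ONeillSemiRiemannian1983, Ch. 10, Lemma 49] -/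
theorem exists_endmanifold_variation_local
    (hν : ContMDiff I' I.tangent ∞ (fun z ↦ (TotalSpace.mk' E (ι z) (ν z) : TangentBundle I M)))
    {z₀ : N} (hι : Injective (mfderiv I' I ι z₀)) (hνz : ν z₀ ∉ range (mfderiv I' I ι z₀))
    (hdim : Module.finrank ℝ E' + 1 = Module.finrank ℝ E)
    {a b L : ℝ} (ha : a < 0) (hL : 0 < L) (hb : L < b)
    (hdom : Ioo a b ⊆ maximalGeodesicDomain cov (ι z₀) (ν z₀))
    {V : Π t : ℝ, TangentSpace I (expMap cov (ι z₀) (t • ν z₀))}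
    (hV : ∀ t ∈ Ioo a b, ContMDiffAt 𝓘(ℝ, ℝ) I.tangent ∞
      (fun t ↦ (TotalSpace.mk' E (expMap cov (ι z₀) (t • ν z₀)) (V t) : TangentBundle I M)) t)
    (hVL : V L = 0) {w₀ : TangentSpace I' z₀} (hV0 : V 0 = mfderiv I' I ι z₀ w₀) :
    ∃ (x : ℝ → ℝ → M) (ζ : ℝ → N),
      (∀ t ∈ Icc 0 L, ∀ᶠ q in 𝓝 ((t, 0) : ℝ × ℝ),
        ContMDiffAt (𝓘(ℝ, ℝ).prod 𝓘(ℝ, ℝ)) I ∞ (uncurry x) q) ∧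
      (∀ᶠ σ in 𝓝 (0 : ℝ), ContMDiffAt 𝓘(ℝ, ℝ) I' ∞ ζ σ) ∧
      ζ 0 = z₀ ∧ velocity I' ζ 0 = w₀ ∧
      (∀ σ, x 0 σ = ι (ζ σ)) ∧ (∀ σ, x L σ = expMap cov (ι z₀) (L • ν z₀)) ∧
      (∀ᶠ t in 𝓝ˢ (Icc 0 L), x t 0 = expMap cov (ι z₀) (t • ν z₀)) ∧
      (∀ᶠ t in 𝓝ˢ (Icc 0 L), velocity I (x t) 0 = V t) := by
  classical
  have hTne : (((⊤ : ℕ∞) : ℕ∞ω)) ≠ 0 := by simp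
  /- 1. The normal exponential map `Eν`, its domain `𝓓`, the normal geodesic `γ`. -/
  set Eν : N × ℝ → M := fun q ↦ expMap cov (ι q.1) (q.2 • ν q.1) with hEν
  set 𝓓 : Set (N × ℝ) := {q | q.2 ∈ maximalGeodesicDomain cov (ι q.1) (ν q.1)} with h𝓓
  have h𝓓o : IsOpen 𝓓 := isOpen_normalExpDomain (cov := cov) (k := (⊤ : ℕ∞)) le_top hν
  have hEsm : ContMDiffOn (I'.prod 𝓘(ℝ, ℝ)) I ∞ Eν 𝓓 :=
    contMDiffOn_normalExp (cov := cov) (k := (⊤ : ℕ∞)) le_top hν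
  set γ : ℝ → M := fun t ↦ expMap cov (ι z₀) (t • ν z₀) with hγ
  have hγE : ∀ t, γ t = Eν (z₀, t) := fun t ↦ rfl
  have hγc : ∀ t ∈ Ioo a b, ContinuousAt γ t := fun t ht ↦
    ((FiberBundle.continuous_proj E (TangentSpace I : M → Type _)).continuousAt.comp
      (hV t ht).continuousAt :)
  /- 2. The local inverse `Ψ` of `Eν` at `(z₀, 0)`. -/
  have hLD : IsLocalDiffeomorphAt (I'.prod 𝓘(ℝ, ℝ)) I ∞ Eν (z₀, 0) :=
    isLocalDiffeomorphAt_normalExp_zero (cov := cov) (k := (⊤ : ℕ∞)) le_top hν hι hνz hdim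
  set Ψ := hLD.localInverse with hΨ
  have hΨsrc0 : Eν (z₀, 0) ∈ Ψ.source := hLD.localInverse_mem_source
  have hΨtgt0 : (z₀, (0 : ℝ)) ∈ Ψ.target := hLD.localInverse_mem_target
  have hright : ∀ p ∈ Ψ.source, Eν (Ψ p) = p := fun p hp ↦ hLD.localInverse_right_inv hp
  have hleft : ∀ q ∈ Ψ.target, Ψ (Eν q) = q := fun q hq ↦ hLD.localInverse_left_inv hq
  have hΨsm : ∀ p ∈ Ψ.source, ContMDiffAt I (I'.prod 𝓘(ℝ, ℝ)) ∞ Ψ p := fun p hp ↦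
    hLD.localInverse_contMDiffOn.contMDiffAt (Ψ.open_source.mem_nhds hp)
  -- the linear algebra at the foot: `dΨ(dι w) = (w, 0)`
  have hLA : ∀ w : TangentSpace I' z₀, mfderiv I (I'.prod 𝓘(ℝ, ℝ)) Ψ (Eν (z₀, 0))
      (mfderiv I' I ι z₀ w) = ((w, 0) : TangentSpace (I'.prod 𝓘(ℝ, ℝ)) (z₀, (0 : ℝ))) := by
    intro w
    have h1 : mfderiv (I'.prod 𝓘(ℝ, ℝ)) I Eν (z₀, 0)
        ((w, (0 : ℝ)) : TangentSpace (I'.prod 𝓘(ℝ, ℝ)) (z₀, (0 : ℝ))) = mfderiv I' I ι z₀ w := by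
      rw [hEν, mfderiv_normalExp_zero_apply' (cov := cov) (k := (⊤ : ℕ∞)) le_top hν z₀ w 0,
        zero_smul, add_zero]
    have h2 := (hLD.mfderivToContinuousLinearEquiv hTne).symm_apply_apply
      ((w, (0 : ℝ)) : TangentSpace (I'.prod 𝓘(ℝ, ℝ)) (z₀, (0 : ℝ)))
    rw [← h1]
    exact h2
  /- 3. The floating variation `x₁(t, σ) = exp_{γ t}(σ V t)`. -/
  set x₁ : ℝ → ℝ → M := fun t σ ↦ expMap cov (γ t) (σ • V t) with hx₁
  have hx₁0 : ∀ t, x₁ t 0 = γ t := fun t ↦ by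
    simp only [hx₁, zero_smul]
    exact expMap_zero (cov := cov) (γ t)
  have hx₁L : ∀ σ, x₁ L σ = γ L := fun σ ↦ by
    simp only [hx₁, hVL, smul_zero]
    exact expMap_zero (cov := cov) (γ L)
  have hx₁v : ∀ t, velocity I (x₁ t) 0 = V t := fun t ↦
    velocity_expMap_smul_zero (cov := cov) (γ t) (V t)
  set 𝓔 : Set (TangentBundle I M) :=
    {p | (1 : ℝ) ∈ maximalGeodesicDomain cov p.proj p.2} with h𝓔
  have h𝓔o : IsOpen 𝓔 :=
    isOpen_setOf_one_mem_maximalGeodesicDomain (cov := cov) (k := (⊤ : ℕ∞)) le_top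
  have hexp : ContMDiffOn I.tangent I ∞ (fun p : TangentBundle I M ↦ expMap cov p.proj p.2) 𝓔 :=
    contMDiffOn_expMap_totalSpace (cov := cov) (k := (⊤ : ℕ∞)) le_top
  have hmem0 : ∀ t, (TotalSpace.mk' E (γ t) ((0 : ℝ) • V t) : TangentBundle I M) ∈ 𝓔 := fun t ↦
    ((mem_maximalGeodesicDomain_iff_smul_mem_expDomain (cov := cov) (γ t) (V t) 0).1
      (maximalGeodesic_spec' (cov := cov) (γ t) (V t)).2.1).2
  -- smoothness of `x₁` at the good points
  have hx₁sm : ∀ q : ℝ × ℝ, q.1 ∈ Ioo a b →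
      (TotalSpace.mk' E (γ q.1) (q.2 • V q.1) : TangentBundle I M) ∈ 𝓔 →
      ContMDiffAt (𝓘(ℝ, ℝ).prod 𝓘(ℝ, ℝ)) I ∞ (uncurry x₁) q := by
    rintro ⟨t, σ⟩ ht hmem
    have h := contMDiffAt_uncurry_normalVariation (cov := cov) h𝓔o hexp (c := γ) (V := V)
      (t := σ) (s := t) (hV t ht) hmem
    have hswap : ContMDiffAt (𝓘(ℝ, ℝ).prod 𝓘(ℝ, ℝ)) (𝓘(ℝ, ℝ).prod 𝓘(ℝ, ℝ)) ∞
        (fun q : ℝ × ℝ ↦ (q.2, q.1)) (t, σ) :=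
      contMDiffAt_snd.prodMk contMDiffAt_fst
    exact h.comp (t, σ) hswap
  have hx₁slice : ∀ t σ, ContMDiffAt (𝓘(ℝ, ℝ).prod 𝓘(ℝ, ℝ)) I ∞ (uncurry x₁) (t, σ) →
      ContMDiffAt 𝓘(ℝ, ℝ) I ∞ (x₁ t) σ := fun t σ h ↦
    h.comp σ (contMDiffAt_const.prodMk contMDiffAt_id)
  have hx₁ev : ∀ t ∈ Ioo a b, ∀ᶠ q in 𝓝 ((t, (0 : ℝ)) : ℝ × ℝ), q.1 ∈ Ioo a b ∧
      (TotalSpace.mk' E (γ q.1) (q.2 • V q.1) : TangentBundle I M) ∈ 𝓔 := by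
    intro t ht
    have hc : ContinuousAt
        (fun q : ℝ × ℝ ↦ (TotalSpace.mk' E (γ q.1) (q.2 • V q.1) : TangentBundle I M)) (t, 0) := by
      have h := contMDiffAt_totalSpaceMk_smul (I := I) (hV t ht) (0 : ℝ)
      have hswap : ContMDiffAt (𝓘(ℝ, ℝ).prod 𝓘(ℝ, ℝ)) (𝓘(ℝ, ℝ).prod 𝓘(ℝ, ℝ)) ∞
          (fun q : ℝ × ℝ ↦ (q.2, q.1)) (t, 0) :=
        contMDiffAt_snd.prodMk contMDiffAt_fst
      exact (h.comp (t, (0 : ℝ)) hswap).continuousAt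
    filter_upwards [(continuous_fst.continuousAt (x := ((t, (0 : ℝ)) : ℝ × ℝ))).eventually
      (isOpen_Ioo.mem_nhds ht), hc.preimage_mem_nhds (h𝓔o.mem_nhds (hmem0 t))] with q h1 h2
    exact ⟨h1, h2⟩
  /- 4. The choice of `t₁`: on `[-t₁, t₁]` we are inside `(a, b)`, `(z₀, t) ∈ Ψ.target` and
  `γ t ∈ Ψ.source`. -/
  have h0ab : (0 : ℝ) ∈ Ioo a b := ⟨ha, hL.trans hb⟩
  obtain ⟨t₁, ht₁, ht₁L, hT⟩ : ∃ t₁ : ℝ, 0 < t₁ ∧ t₁ < L ∧ ∀ t ∈ Icc (-t₁) t₁,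
      t ∈ Ioo a b ∧ (z₀, t) ∈ Ψ.target ∧ γ t ∈ Ψ.source := by
    have h1 : ∀ᶠ t in 𝓝 (0 : ℝ), t ∈ Ioo a b := isOpen_Ioo.mem_nhds h0ab
    have h2 : ∀ᶠ t in 𝓝 (0 : ℝ), (z₀, t) ∈ Ψ.target :=
      (Continuous.prodMk_right z₀).continuousAt.preimage_mem_nhds
        (Ψ.open_target.mem_nhds hΨtgt0)
    have h3 : ∀ᶠ t in 𝓝 (0 : ℝ), γ t ∈ Ψ.source :=
      (hγc 0 h0ab).preimage_mem_nhds (Ψ.open_source.mem_nhds hΨsrc0)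
    obtain ⟨ε, hε, hεsub⟩ := Metric.mem_nhds_iff.1 (h1.and (h2.and h3))
    refine ⟨min (ε / 2) (L / 2), by positivity, by
      linarith [min_le_right (ε / 2) (L / 2)], fun t ht ↦ hεsub ?_⟩
    rw [Metric.mem_ball, Real.dist_eq, sub_zero, abs_lt]
    constructor <;> linarith [ht.1, ht.2, min_le_left (ε / 2) (L / 2)]
  /- 5. The cutoff, the correction and the corrected variation. -/
  obtain ⟨χ, hχsm, hχ0, hχ1⟩ := exists_smooth_cutoff ht₁
  set r : ℝ → ℝ := fun σ ↦ (Ψ (x₁ 0 σ)).2 with hr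
  set ζ : ℝ → N := fun σ ↦ (Ψ (x₁ 0 σ)).1 with hζ
  set G : ℝ → ℝ → N × ℝ := fun t σ ↦
    ((Ψ (x₁ t σ)).1, (Ψ (x₁ t σ)).2 - (1 - χ t) * r σ) with hG
  set x₂ : ℝ → ℝ → M := fun t σ ↦ Eν (G t σ) with hx₂
  set x : ℝ → ℝ → M := fun t σ ↦ if t ≤ 3 * t₁ / 4 then x₂ t σ else x₁ t σ with hx
  -- values at `σ = 0`
  have hΨγ : ∀ t ∈ Icc (-t₁) t₁, Ψ (γ t) = (z₀, t) := fun t ht ↦ hleft _ (hT t ht).2.1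
  have h0t₁ : (0 : ℝ) ∈ Icc (-t₁) t₁ := ⟨by linarith, ht₁.le⟩
  have hr0 : r 0 = 0 := by
    simp only [hr, hx₁0, hΨγ 0 h0t₁]
  have hζ0 : ζ 0 = z₀ := by
    simp only [hζ, hx₁0, hΨγ 0 h0t₁]
  have hG0 : ∀ t ∈ Icc (-t₁) t₁, G t 0 = (z₀, t) := fun t ht ↦ by
    simp only [hG, hx₁0, hΨγ t ht, hr0, mul_zero, sub_zero]
  /- 6. Smoothness of `G` and `x₂` at the good points. -/
  have hrsm : ∀ σ, (TotalSpace.mk' E (γ 0) (σ • V 0) : TangentBundle I M) ∈ 𝓔 →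
      x₁ 0 σ ∈ Ψ.source → ContMDiffAt 𝓘(ℝ, ℝ) (I'.prod 𝓘(ℝ, ℝ)) ∞ (fun σ ↦ Ψ (x₁ 0 σ)) σ :=
    fun σ h4 h5 ↦ (hΨsm _ h5).comp σ (hx₁slice 0 σ (hx₁sm (0, σ) h0ab h4))
  have hGsm : ∀ q : ℝ × ℝ, q.1 ∈ Ioo a b →
      (TotalSpace.mk' E (γ q.1) (q.2 • V q.1) : TangentBundle I M) ∈ 𝓔 →
      x₁ q.1 q.2 ∈ Ψ.source →
      (TotalSpace.mk' E (γ 0) (q.2 • V 0) : TangentBundle I M) ∈ 𝓔 →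
      x₁ 0 q.2 ∈ Ψ.source →
      ContMDiffAt (𝓘(ℝ, ℝ).prod 𝓘(ℝ, ℝ)) (I'.prod 𝓘(ℝ, ℝ)) ∞ (uncurry G) q := by
    intro q h1 h2 h3 h4 h5
    have hΨx : ContMDiffAt (𝓘(ℝ, ℝ).prod 𝓘(ℝ, ℝ)) (I'.prod 𝓘(ℝ, ℝ)) ∞
        (fun q : ℝ × ℝ ↦ Ψ (uncurry x₁ q)) q := (hΨsm _ h3).comp q (hx₁sm q h1 h2)
    have hA : ContMDiffAt (𝓘(ℝ, ℝ).prod 𝓘(ℝ, ℝ)) 𝓘(ℝ, ℝ) ∞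
        (fun q : ℝ × ℝ ↦ (Ψ (uncurry x₁ q)).2) q := contMDiffAt_snd.comp q hΨx
    have hB : ContMDiffAt (𝓘(ℝ, ℝ).prod 𝓘(ℝ, ℝ)) 𝓘(ℝ, ℝ) ∞
        (fun q : ℝ × ℝ ↦ 1 - χ q.1) q :=
      (contDiff_const.sub hχsm).contMDiff.contMDiffAt.comp q contMDiffAt_fst
    have hC : ContMDiffAt (𝓘(ℝ, ℝ).prod 𝓘(ℝ, ℝ)) 𝓘(ℝ, ℝ) ∞ (fun q : ℝ × ℝ ↦ r q.2) q :=
      (contMDiffAt_snd.comp _ (hrsm q.2 h4 h5)).comp q contMDiffAt_snd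
    exact (contMDiffAt_fst.comp q hΨx).prodMk (hA.sub (hB.smul hC))
  have hx₂sm : ∀ q : ℝ × ℝ, q.1 ∈ Ioo a b →
      (TotalSpace.mk' E (γ q.1) (q.2 • V q.1) : TangentBundle I M) ∈ 𝓔 →
      x₁ q.1 q.2 ∈ Ψ.source →
      (TotalSpace.mk' E (γ 0) (q.2 • V 0) : TangentBundle I M) ∈ 𝓔 →
      x₁ 0 q.2 ∈ Ψ.source → uncurry G q ∈ 𝓓 →
      ContMDiffAt (𝓘(ℝ, ℝ).prod 𝓘(ℝ, ℝ)) I ∞ (uncurry x₂) q :=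
    fun q h1 h2 h3 h4 h5 h6 ↦
      (hEsm.contMDiffAt (h𝓓o.mem_nhds h6)).comp q (hGsm q h1 h2 h3 h4 h5)
  -- the good points form a neighbourhood of `(t, 0)` for `t ∈ [-t₁, t₁]`
  have hsrc_ev : ∀ t ∈ Icc (-t₁) t₁, ∀ᶠ q in 𝓝 ((t, (0 : ℝ)) : ℝ × ℝ),
      x₁ q.1 q.2 ∈ Ψ.source := by
    intro t ht
    have hc : ContinuousAt (uncurry x₁) (t, 0) :=
      (hx₁sm (t, 0) (hT t ht).1 (hmem0 t)).continuousAt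
    have h := hc.preimage_mem_nhds (Ψ.open_source.mem_nhds (by
      show uncurry x₁ (t, 0) ∈ Ψ.source
      simp only [uncurry, hx₁0]
      exact (hT t ht).2.2))
    exact h
  have hev : ∀ t ∈ Icc (-t₁) t₁, ∀ᶠ q in 𝓝 ((t, (0 : ℝ)) : ℝ × ℝ), q.1 ∈ Ioo a b ∧
      (TotalSpace.mk' E (γ q.1) (q.2 • V q.1) : TangentBundle I M) ∈ 𝓔 ∧
      x₁ q.1 q.2 ∈ Ψ.source ∧
      (TotalSpace.mk' E (γ 0) (q.2 • V 0) : TangentBundle I M) ∈ 𝓔 ∧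
      x₁ 0 q.2 ∈ Ψ.source ∧ uncurry G q ∈ 𝓓 := by
    intro t ht
    have h12 := hx₁ev t (hT t ht).1
    have h3 := hsrc_ev t ht
    -- conditions at `(0, q.2)`, pulled back along `q ↦ (0, q.2)`
    have h45 : ∀ᶠ q in 𝓝 ((t, (0 : ℝ)) : ℝ × ℝ),
        (TotalSpace.mk' E (γ 0) (q.2 • V 0) : TangentBundle I M) ∈ 𝓔 ∧ x₁ 0 q.2 ∈ Ψ.source := by
      have hten : Tendsto (fun q : ℝ × ℝ ↦ ((0 : ℝ), q.2)) (𝓝 ((t, (0 : ℝ)) : ℝ × ℝ))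
          (𝓝 (((0 : ℝ), (0 : ℝ)) : ℝ × ℝ)) :=
        (continuous_const.prodMk continuous_snd).continuousAt
      have h := hten.eventually ((hx₁ev 0 h0ab).and (hsrc_ev 0 h0t₁))
      filter_upwards [h] with q hq
      exact ⟨hq.1.2, hq.2⟩
    -- condition on `G`, by continuity of `G` at `(t, 0)` and `G(t, 0) = (z₀, t) ∈ 𝓓`
    have h6 : ∀ᶠ q in 𝓝 ((t, (0 : ℝ)) : ℝ × ℝ), uncurry G q ∈ 𝓓 := by
      have hc : ContinuousAt (uncurry G) (t, 0) :=
        (hGsm (t, 0) (hT t ht).1 (hmem0 t) (by simp only [hx₁0]; exact (hT t ht).2.2)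
          (hmem0 0) (by simp only [hx₁0]; exact (hT 0 h0t₁).2.2)).continuousAt
      refine hc.preimage_mem_nhds (h𝓓o.mem_nhds ?_)
      show G t 0 ∈ 𝓓
      rw [hG0 t ht]
      exact hdom (hT t ht).1
    filter_upwards [h12, h3, h45, h6] with q hq h3 h45 h6
    exact ⟨hq.1, hq.2, h3, h45.1, h45.2, h6⟩
  /- 7. The conclusions. -/
  have hIcc : ∀ t ∈ Ioo (-t₁) b, t ≤ 3 * t₁ / 4 → t ∈ Icc (-t₁) t₁ := fun t ht hle ↦
    ⟨ht.1.le, by linarith⟩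
  have hnhds : Ioo (-t₁) b ∈ 𝓝ˢ (Icc 0 L) :=
    isOpen_Ioo.mem_nhdsSet.2 (Icc_subset_Ioo (by linarith) hb)
  refine ⟨x, ζ, ?_, ?_, hζ0, ?_, ?_, ?_, ?_, ?_⟩
  · -- smoothness of `x` near `[0, L] × {0}`
    intro t ht
    rcases lt_trichotomy t (3 * t₁ / 4) with hlt | heq | hgt
    · -- near `(t, 0)` the map `x` is `x₂`
      have ht' : t ∈ Icc (-t₁) t₁ := ⟨by linarith [ht.1], by linarith⟩
      have h1 : ∀ᶠ q in 𝓝 ((t, (0 : ℝ)) : ℝ × ℝ), q.1 < 3 * t₁ / 4 :=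
        (continuous_fst.continuousAt (x := ((t, (0 : ℝ)) : ℝ × ℝ))).eventually
          (Iio_mem_nhds hlt)
      filter_upwards [h1.eventually_nhds, hev t ht'] with q hq hc
      have heq : uncurry x =ᶠ[𝓝 q] uncurry x₂ := by
        filter_upwards [hq] with q' hq'
        simp only [uncurry, hx, if_pos hq'.le]
      exact (hx₂sm q hc.1 hc.2.1 hc.2.2.1 hc.2.2.2.1 hc.2.2.2.2.1 hc.2.2.2.2.2).congr_of_eventuallyEq
        heq
    · -- near `(3t₁/4, 0)` the map `x` is `x₁` (the two branches agree there)
      have ht' : t ∈ Icc (-t₁) t₁ := ⟨by linarith [ht.1], by linarith⟩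
      have h1 : ∀ᶠ q in 𝓝 ((t, (0 : ℝ)) : ℝ × ℝ), q.1 ∈ Ioo (t₁ / 2) t₁ :=
        (continuous_fst.continuousAt (x := ((t, (0 : ℝ)) : ℝ × ℝ))).eventually
          (isOpen_Ioo.mem_nhds ⟨by linarith, by linarith⟩)
      filter_upwards [(h1.and (hev t ht')).eventually_nhds, hev t ht'] with q hq hc
      have heq : uncurry x =ᶠ[𝓝 q] uncurry x₁ := by
        filter_upwards [hq] with q' hq'
        show x q'.1 q'.2 = x₁ q'.1 q'.2
        by_cases hle : q'.1 ≤ 3 * t₁ / 4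
        · have hχ : χ q'.1 = 1 := hχ1 _ hq'.1.1.le
          simp only [hx, if_pos hle, hx₂, hG, hχ, sub_self, zero_mul, sub_zero, Prod.mk.eta]
          exact hright _ hq'.2.2.2.1
        · simp only [hx, if_neg hle]
      exact (hx₁sm q hc.1 hc.2.1).congr_of_eventuallyEq heq
    · -- near `(t, 0)` with `t > 3t₁/4` the map `x` is `x₁`
      have h1 : ∀ᶠ q in 𝓝 ((t, (0 : ℝ)) : ℝ × ℝ), 3 * t₁ / 4 < q.1 :=
        (continuous_fst.continuousAt (x := ((t, (0 : ℝ)) : ℝ × ℝ))).eventually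
          (Ioi_mem_nhds hgt)
      filter_upwards [h1.eventually_nhds, hx₁ev t ⟨by linarith [ht.1], ht.2.trans_lt hb⟩]
        with q hq hc
      have heq : uncurry x =ᶠ[𝓝 q] uncurry x₁ := by
        filter_upwards [hq] with q' hq'
        simp only [uncurry, hx, if_neg (not_le.2 hq')]
      exact (hx₁sm q hc.1 hc.2).congr_of_eventuallyEq heq
  · -- smoothness of `ζ` near `0`
    have hten : Tendsto (fun σ : ℝ ↦ ((0 : ℝ), σ)) (𝓝 (0 : ℝ)) (𝓝 (((0 : ℝ), (0 : ℝ)) : ℝ × ℝ)) :=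
      (continuous_const.prodMk continuous_id).continuousAt
    have h := hten.eventually ((hx₁ev 0 h0ab).and (hsrc_ev 0 h0t₁))
    filter_upwards [h] with σ hσ
    exact contMDiffAt_fst.comp σ (hrsm σ hσ.1.2 hσ.2)
  · -- `ζ'(0) = w₀`
    have hc : ContMDiffAt 𝓘(ℝ, ℝ) I ∞ (x₁ 0) 0 := hx₁slice 0 0 (hx₁sm (0, 0) h0ab (hmem0 0))
    have hsrc : x₁ 0 0 ∈ Ψ.source := by
      rw [hx₁0]
      exact (hT 0 h0t₁).2.2
    have hd := ((hasMFDerivAt_fst (I := I') (I' := 𝓘(ℝ, ℝ)) _).comp 0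
      (((hΨsm _ hsrc).mdifferentiableAt hTne).hasMFDerivAt.comp 0
        (hc.mdifferentiableAt hTne).hasMFDerivAt)).mfderiv
    change mfderiv 𝓘(ℝ, ℝ) I' (Prod.fst ∘ Ψ ∘ x₁ 0) 0 1 = w₀
    rw [hd]
    change (mfderiv I (I'.prod 𝓘(ℝ, ℝ)) Ψ (x₁ 0 0) (velocity I (x₁ 0) 0)).1 = w₀
    rw [hx₁v 0, hV0, hx₁0 0, hγE 0, hLA w₀]
  · -- the first transverse curve lies on the hypersurface
    intro σ
    have h0 : (0 : ℝ) ≤ 3 * t₁ / 4 := by positivity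
    simp only [hx, if_pos h0, hx₂, hG, hχ0 0 (by positivity), sub_zero, one_mul]
    show Eν (ζ σ, r σ - r σ) = ι (ζ σ)
    rw [sub_self]
    exact normalExp_zero (cov := cov) (ν := ν) (ζ σ)
  · -- the last transverse curve is constant
    intro σ
    have h0 : ¬ L ≤ 3 * t₁ / 4 := by
      rw [not_le]
      linarith
    simp only [hx, if_neg h0, hx₁L]
    rfl
  · -- the base curve
    filter_upwards [hnhds] with t ht
    by_cases hle : t ≤ 3 * t₁ / 4
    · simp only [hx, if_pos hle, hx₂, hG0 t (hIcc t ht hle)]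
      rfl
    · simp only [hx, if_neg hle, hx₁0]
      rfl
  · -- the variation field
    filter_upwards [hnhds] with t ht
    by_cases hle : t ≤ 3 * t₁ / 4
    · have ht' := hIcc t ht hle
      have hxt : x t = x₂ t := funext fun σ ↦ if_pos hle
      rw [hxt]
      have hc : ContMDiffAt 𝓘(ℝ, ℝ) I ∞ (x₁ t) 0 :=
        hx₁slice t 0 (hx₁sm (t, 0) (hT t ht').1 (hmem0 t))
      have hsrc : x₁ t 0 ∈ Ψ.source := by
        rw [hx₁0]
        exact (hT t ht').2.2
      have hP : MDifferentiableAt 𝓘(ℝ, ℝ) (I'.prod 𝓘(ℝ, ℝ)) (fun σ ↦ Ψ (x₁ t σ)) 0 :=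
        ((hΨsm _ hsrc).comp 0 hc).mdifferentiableAt hTne
      have hP0 : Ψ (x₁ t 0) = (z₀, t) := by
        rw [hx₁0]
        exact hΨγ t ht'
      have hF : MDifferentiableAt (I'.prod 𝓘(ℝ, ℝ)) I Eν ((fun σ ↦ Ψ (x₁ t σ)) 0) := by
        show MDifferentiableAt (I'.prod 𝓘(ℝ, ℝ)) I Eν (Ψ (x₁ t 0))
        rw [hP0]
        exact (hEsm.contMDiffAt (h𝓓o.mem_nhds (hdom (hT t ht').1))).mdifferentiableAt hTne
      -- `r'(0) = 0`
      have hc0 : ContMDiffAt 𝓘(ℝ, ℝ) I ∞ (x₁ 0) 0 := hx₁slice 0 0 (hx₁sm (0, 0) h0ab (hmem0 0))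
      have hsrc0 : x₁ 0 0 ∈ Ψ.source := by
        rw [hx₁0]
        exact (hT 0 h0t₁).2.2
      have hrd := (hasMFDerivAt_snd (I := I') (I' := 𝓘(ℝ, ℝ)) _).comp 0
        (((hΨsm _ hsrc0).mdifferentiableAt hTne).hasMFDerivAt.comp 0
          (hc0.mdifferentiableAt hTne).hasMFDerivAt)
      have hrM : HasMFDerivAt 𝓘(ℝ, ℝ) 𝓘(ℝ, ℝ) r 0
          (0 : TangentSpace 𝓘(ℝ, ℝ) (0 : ℝ) →L[ℝ] ℝ) := by
        refine hrd.congr_mfderiv ?_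
        ext1
        change (mfderiv I (I'.prod 𝓘(ℝ, ℝ)) Ψ (x₁ 0 0) (velocity I (x₁ 0) 0)).2 = 0
        rw [hx₁v 0, hV0, hx₁0 0, hγE 0, hLA w₀]
      have hD := velocity_comp_sub_correction (I := I) (I' := I') (F := Eν)
        (P := fun σ ↦ Ψ (x₁ t σ)) (1 - χ t) hP hF hrM hr0
      have hEΨ : ∀ᶠ p in 𝓝 (x₁ t 0), Eν (Ψ p) = p :=
        Filter.eventually_of_mem (Ψ.open_source.mem_nhds hsrc) hright
      have hD2 := velocity_comp_rightInverse (I := I) (Ψ := Ψ) (F := Eν) (c := x₁ t) hEΨ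
        hc.continuousAt
      change velocity I (fun σ ↦ Eν ((Ψ (x₁ t σ)).1, (Ψ (x₁ t σ)).2 - (1 - χ t) * r σ)) 0 = V t
      rw [hD]
      change velocity I (fun σ ↦ Eν (Ψ (x₁ t σ))) 0 = V t
      rw [hD2, hx₁v t]
    · have hxt : x t = x₁ t := funext fun σ ↦ if_neg hle
      rw [hxt, hx₁v t]

/-- **The endmanifold variation of a normal geodesic** (O'Neill 1983, Ch. 10, Lemma 49: "If
`α ∈ Ω(P, q)`, let `V ∈ T_α(Ω)` … Then there is a `(P, q)` variation `x` of `α` whose variation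
vector field is `V`", for the normal geodesic `γ(t) = exp_{ι z₀}(t ν(z₀))`, `t ∈ [0, L]`, of an
immersed hypersurface `ι : N → M` with smooth transverse field `ν`, `dι_{z₀}` injective,
`ν(z₀) ∉ range dι_{z₀}`, `dim N + 1 = dim M`). Let `V` be a field along `γ`, `C^∞` on an open
interval about `[0, L]` contained in the domain of `γ`, with `V(L) = 0` and `V(0) = dι_{z₀}(w₀)`.
Then there are a `C^∞` two-parameter map `x : ℝ × ℝ → M` and a `C^∞` curve `ζ` in `N` with
`ζ(0) = z₀`, `ζ'(0) = w₀`, first transverse curve `x(0, σ) = ι(ζ(σ))` ON THE HYPERSURFACE, last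
transverse curve constant `x(L, σ) = γ(L)`, base curve `x(t, 0) = γ(t)` and variation field
`∂_σ x(t, 0) = V(t)` for all `t` in a neighbourhood of `[0, L]`
(`exists_endmanifold_variation_local`, made global in both parameters by smooth clamps,
`exists_clamped_variation`). [cite: ONeillSemiRiemannian1983, Ch. 10, Lemma 49] -/
theorem exists_endmanifold_variation
    (hν : ContMDiff I' I.tangent ∞ (fun z ↦ (TotalSpace.mk' E (ι z) (ν z) : TangentBundle I M)))
    {z₀ : N} (hι : Injective (mfderiv I' I ι z₀)) (hνz : ν z₀ ∉ range (mfderiv I' I ι z₀))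
    (hdim : Module.finrank ℝ E' + 1 = Module.finrank ℝ E)
    {a b L : ℝ} (ha : a < 0) (hL : 0 < L) (hb : L < b)
    (hdom : Ioo a b ⊆ maximalGeodesicDomain cov (ι z₀) (ν z₀))
    {V : Π t : ℝ, TangentSpace I (expMap cov (ι z₀) (t • ν z₀))}
    (hV : ∀ t ∈ Ioo a b, ContMDiffAt 𝓘(ℝ, ℝ) I.tangent ∞
      (fun t ↦ (TotalSpace.mk' E (expMap cov (ι z₀) (t • ν z₀)) (V t) : TangentBundle I M)) t)
    (hVL : V L = 0) {w₀ : TangentSpace I' z₀} (hV0 : V 0 = mfderiv I' I ι z₀ w₀) :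
    ∃ (x : ℝ → ℝ → M) (ζ : ℝ → N),
      ContMDiff (𝓘(ℝ, ℝ).prod 𝓘(ℝ, ℝ)) I ∞ (uncurry x) ∧ ContMDiff 𝓘(ℝ, ℝ) I' ∞ ζ ∧
      ζ 0 = z₀ ∧ velocity I' ζ 0 = w₀ ∧
      (∀ σ, x 0 σ = ι (ζ σ)) ∧ (∀ σ, x L σ = expMap cov (ι z₀) (L • ν z₀)) ∧
      (∀ᶠ t in 𝓝ˢ (Icc 0 L), x t 0 = expMap cov (ι z₀) (t • ν z₀)) ∧
      (∀ᶠ t in 𝓝ˢ (Icc 0 L), velocity I (x t) 0 = V t) := by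
  obtain ⟨x, ζ, h1, h2, h3, h4, h5, h6, h7, h8⟩ :=
    exists_endmanifold_variation_local (cov := cov) hν hι hνz hdim ha hL hb hdom hV hVL hV0
  obtain ⟨x', ζ', g1, g2, g3, g4, g5, g6, g7, g8⟩ :=
    exists_clamped_variation (I := I) (I' := I') (ι := ι)
      (γ := fun t ↦ expMap cov (ι z₀) (t • ν z₀)) (V := V) hL.le h1 h2 h5 h6 h7 h8
  exact ⟨x', ζ', g1, g2, g3.trans h3, g4.trans h4, g5, g6, g7, g8⟩

end Endmanifold

end Literature.Geometry.Riemannian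

end
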